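import Summits.MatrixMultiplication.MatrixMultiplication.Theorems.SaturationLadderWindow109A
import Summits.MatrixMultiplication.MatrixMultiplication.Theorems.SaturationLadderWindow109B
import Summits.MatrixMultiplication.MatrixMultiplication.Theorems.SaturationLadderWindow109C
import Summits.MatrixMultiplication.MatrixMultiplication.Theorems.SaturationLadderUniformWindow
import HarnessLib

/-!
# SaturationLadder — Kernel XXVII (vii): the uniform rung `U(109/100)` — `Δ(r) ≤ 1.09` for ALL `r ≥ 1`

Support for the deciding crux `SubexpSaturation` (h₁, item 25909) of `Theses/SaturationLadder.lean`
(cell `decomp-mm`, lens «grading / quantitative ladder», gen 55).  No new hypotheses, no `sorry`.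

THE CRUX asks: for every `c > 0` there is an onset `t₀(c) < 1` such that every `t ∈ [t₀, 1)` is tight
(`ω(1,t,r) = 1 + r`) at some `r ∈ [1, e^{c/(1−t)}]`; equivalently the frontier defect
`Δ(r) := (1 − τ_ℂ(r))·log r → 0` (`Theorems/SaturationLadderUniformDefect.lean`).  The quantitative
ladder of this cell proves the clause for explicit rates `c` with onset `t₀ = 0`:

| rate `c` with onset `0` (`Δ(r) ≤ c ∀ r ≥ 1`) | file |
|---|---|
| `2 log 2 = 1.386…` | `Theorems/SaturationLadderUniformDefect.lean` (`uniformClause_log_four`) |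
| `6/5` (and `1.1` for `r ≥ e^{46}`) | `Theorems/SaturationLadderUniformSixFifths.lean` (gen 54) |
| **`109/100`** (hence `1.1` for all `r ≥ 1`) | this file (gen 55) |

MAIN RESULTS.
* `uniformClause_109` — **`U(1.09)`: every `t ∈ [0,1)` is tight at some `r ∈ [1, e^{1.09/(1−t)}]`.**
* `frontierDefect_le_109` — **`Δ(r) ≤ 1.09` for every `r ≥ 1`**; `frontierDefect_le_eleven_tenths_all`
  removes the threshold `r ≥ e^{46}` of gen 54's `Δ ≤ 1.1`.
* `subexpClause_of_ge` — the crux's clause, verbatim, for every rate `c ≥ 109/100` (onset `0`).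

ASSEMBLY (`uniformClause_of_window`): (a) the explicit stage-2 twin-family clause at rate `1.09` from
its onset `t₁₄₇ = fT 147 = 325605/329078 ≈ 0.989446` (`twinClause_109` =
`twinClause_explicit_of_familyY` with `familyY64` and the numerics `rate_ineq_109`:
`(j+2)(47j+37) log 2 ≤ 1.09 (j+1)(30j+37)` for `j ≥ 147`, `log 2 < 0.6931471808`); (b) the certified
window `[0, t₁₄₇]` of `Theorems/SaturationLadderWindow109A|B|C.lean` (56 chord pieces through 59 exact
points: 54 twin points — 44 of them new, `Theorems/SaturationLadderTwinTableB|C.lean` —, the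
X-perfect `CW₁₆` point `(4/7, 57/7)`, `(1/2, 9/2)`, `(0, 1)` and the two family points `j = 64, 147`).

WHERE THIS METHOD ENDS (recorded for the next rung).  The monotone family clause (`rate_of_le`) has
the ceiling `inf_j sup_{j' ≥ j} (j'+2)(47j'+37) log 2 / ((j'+1)(30j'+37)) = 47 log 2 / 30 = 1.085931…`:
rate `1.09` needs onset `j₀ = 147`, `1.089` needs `j₀ ≈ 195`, `1.088` needs `j₀ ≈ 290` (beyond the
`2²⁵⁶` range of the kernel's interval logarithms), and NO onset exists below `1.0859…`.  Below that the
explicit clause must interpolate between consecutive family points by chords (gain: the family defect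
itself tends to `c⋆ = 1.0645958…`, `Theorems/SaturationLadderTwinSaturation.lean`), or use the optimal
twin types (`c₂ = (5 log 5 − 7 log 2)/3 = 1.0650…`); the crux itself needs `c → 0`, i.e. constructions
beyond the stage-2 family (the far-edge census of `Theorems/SaturationLadderStageCeiling*.lean`).

References: D. Coppersmith, S. Winograd, J. Symbolic Comput. 9 (1990) §§6, 8 (key
`CoppersmithWinograd1990`); J. Alman, R. Duan, V. Vassilevska Williams, Y. Xu, Z. Xu, R. Zhou, SODA
2025, §3.4 (key `AlmanDuanVassilevskaWilliamsXuXuZhou2025`); G. Lotti, F. Romani, Theoret. Comput.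
Sci. 23 (1983) 171–185, §1 (key `LottiRomani1983`); X. Huang, V. Y. Pan, J. Complexity 14 (1998) §2
(key `HuangPan1998`); F. Le Gall, F. Urrutia, SODA 2018, §1 (key `LeGallUrrutia2018`: `α > 0.31389`).
-/

set_option linter.dupNamespace false
-- (single-conjunct summit: the namespace repeats `MatrixMultiplication`)

noncomputable section

namespace Summit.MatrixMultiplication.MatrixMultiplication.Theorems.SaturationLadderUniform109

open Literature.Computability.AlgebraicComplexity
open Summit.MatrixMultiplication.MatrixMultiplication.Theorems.SaturationLadderTwinFamily
open Summit.MatrixMultiplication.MatrixMultiplication.Theorems.SaturationLadderTwinFamilyY64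
  (familyY64)
open Summit.MatrixMultiplication.MatrixMultiplication.Theorems.SaturationLadderUniformCorners
  (log_four_gt)
open Summit.MatrixMultiplication.MatrixMultiplication.Theorems.SaturationLadderUniformDefect
  (uniformClause_iff_defect uniformClause_mono)
open Summit.MatrixMultiplication.MatrixMultiplication.Theorems.SaturationLadderUniformWindow
  (uniformClause_of_window defect_le_beyond_onset twinClause_explicit_of_familyY)
open Summit.MatrixMultiplication.MatrixMultiplication.Theorems.SaturationLadderSixFifthsWindow
  (cover_append)
open Summit.MatrixMultiplication.MatrixMultiplication.Theorems.SaturationLadderWindow109Points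
  (fT_147)
open Summit.MatrixMultiplication.MatrixMultiplication.Theorems.SaturationLadderWindow109A (coverA)
open Summit.MatrixMultiplication.MatrixMultiplication.Theorems.SaturationLadderWindow109B (coverB)
open Summit.MatrixMultiplication.MatrixMultiplication.Theorems.SaturationLadderWindow109C (coverC)

/-! ## §1 The explicit family clause at rate `109/100` (onset `j₀ = 147`) -/

/-- Numerics: `(j+2)(47j+37)·log 2 ≤ 1.09·(j+1)(30j+37)` for `j ≥ 147` (`log 2 < 0.6931471808`;
the margin at `j = 147` is `≈ 17` out of `7.2·10⁵`, and `146` fails). [folklore] -/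
theorem rate_ineq_109 (j : ℕ) (hj : 147 ≤ j) :
    ((j : ℝ) + 2) * (47 * j + 37) * Real.log 2 ≤ 109 / 100 * (((j : ℝ) + 1) * (30 * j + 37)) := by
  have hJ : (147 : ℝ) ≤ j := by exact_mod_cast hj
  have hl := Real.log_two_lt_d9
  have hq : (0 : ℝ) ≤ ((j : ℝ) + 2) * (47 * j + 37) := by positivity
  have h1 : ((j : ℝ) + 2) * (47 * j + 37) * Real.log 2 ≤
      ((j : ℝ) + 2) * (47 * j + 37) * 0.6931471808 := mul_le_mul_of_nonneg_left hl.le hq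
  nlinarith [mul_nonneg (sub_nonneg.2 hJ) (Nat.cast_nonneg j : (0 : ℝ) ≤ j)]

/-- **The stage-2 twin-family clause at rate `1.09` from its explicit onset `t₁₄₇ = fT 147`:** every
`t ∈ [t₁₄₇, 1)` is tight at some `r ∈ [1, e^{1.09/(1−t)}]` (`familyY64`, `twinClause_explicit_of_familyY`).
[cite: CoppersmithWinograd1990, §8] [cite: AlmanDuanVassilevskaWilliamsXuXuZhou2025, §3.4] -/
theorem twinClause_109 : ∀ t : ℝ, fT 147 ≤ t → t < 1 →
    ∃ r : ℝ, 1 ≤ r ∧ r ≤ Real.exp ((109 / 100) / (1 - t)) ∧ omegaRect ℂ 1 t r ≤ 1 + r :=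
  twinClause_explicit_of_familyY 147 (by norm_num)
    (fun j hj => familyY64 j (le_trans (by norm_num) hj)) rate_ineq_109

/-- The family clause read as a defect bound beyond its onset: `Δ(r) ≤ 1.09` for `r ≥ e^{104}`
(`e^{1.09/(1−t₁₄₇)} ≤ e^{104}`; superseded below by the bound for all `r ≥ 1`, kept as the record of
what the family alone gives). [cite: CoppersmithWinograd1990, §8] -/
theorem frontierDefect_le_109_beyond {r : ℝ} (hr : Real.exp 104 ≤ r) :
    (1 - sSup {t : ℝ | omegaRect ℂ 1 t r ≤ 1 + r}) * Real.log r ≤ 109 / 100 := by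
  refine defect_le_beyond_onset (c := 109 / 100) (t₀ := fT 147) (by norm_num) (fT_lt_one 147)
    twinClause_109 r (le_trans ?_ hr)
  rw [fT_147]
  exact Real.exp_le_exp.2 (by norm_num)

/-! ## §2 The window `[0, t₁₄₇]` and the uniform rung -/

/-- **The certified window**: every `t ∈ [0, t₁₄₇]`, `t₁₄₇ = 325605/329078`, is tight at some
`r ∈ [1, e^{1.09/(1−t)}]` (the three partial covers of `Theorems/SaturationLadderWindow109A|B|C.lean`
glued). [cite: LottiRomani1983, §1 (p. 173)] -/
theorem cover : ∀ t : ℝ, 0 ≤ t → t ≤ 325605 / 329078 →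
    ∃ r : ℝ, 1 ≤ r ∧ r ≤ Real.exp ((109 / 100) / (1 - t)) ∧ omegaRect ℂ 1 t r ≤ 1 + r :=
  cover_append coverA (cover_append coverB coverC)

/-- The window in the shape `uniformClause_of_window` wants (`t < fT 147`). [folklore] -/
theorem window_109 : ∀ t : ℝ, 0 ≤ t → t < fT 147 →
    ∃ r : ℝ, 1 ≤ r ∧ r ≤ Real.exp ((109 / 100) / (1 - t)) ∧ omegaRect ℂ 1 t r ≤ 1 + r := by
  intro t ht0 ht1
  rw [fT_147] at ht1
  exact cover t ht0 ht1.le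

/-- **MAIN THEOREM — the uniform rung `U(109/100)`: every `t ∈ [0, 1)` is tight at some
`r ∈ [1, e^{1.09/(1−t)}]`.** [cite: CoppersmithWinograd1990, §8] [cite: LottiRomani1983, §1 (p. 173)] -/
theorem uniformClause_109 :
    ∀ t : ℝ, 0 ≤ t → t < 1 → ∃ r : ℝ, 1 ≤ r ∧
      r ≤ Real.exp ((109 / 100) / (1 - t)) ∧ omegaRect ℂ 1 t r ≤ 1 + r :=
  uniformClause_of_window (c := 109 / 100) le_rfl twinClause_109 window_109

/-- **`Δ(r) = (1 − τ_ℂ(r))·log r ≤ 1.09` for EVERY `r ≥ 1`.** [cite: CoppersmithWinograd1990, §8]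
[cite: HuangPan1998, §2] -/
theorem frontierDefect_le_109 {r : ℝ} (hr : 1 ≤ r) :
    (1 - sSup {t : ℝ | omegaRect ℂ 1 t r ≤ 1 + r}) * Real.log r ≤ 109 / 100 :=
  (uniformClause_iff_defect (by norm_num)).1 uniformClause_109 r hr

/-- `U(1.1)` with onset `0` (gen 54 had the rate `1.1` only beyond `t₆₄`, i.e. for `r ≥ e^{46}`).
[cite: CoppersmithWinograd1990, §8] -/
theorem uniformClause_eleven_tenths :
    ∀ t : ℝ, 0 ≤ t → t < 1 → ∃ r : ℝ, 1 ≤ r ∧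
      r ≤ Real.exp (1.1 / (1 - t)) ∧ omegaRect ℂ 1 t r ≤ 1 + r :=
  uniformClause_mono (by norm_num) uniformClause_109

/-- `Δ(r) ≤ 1.1` for every `r ≥ 1` (no threshold). [cite: CoppersmithWinograd1990, §8] -/
theorem frontierDefect_le_eleven_tenths_all {r : ℝ} (hr : 1 ≤ r) :
    (1 - sSup {t : ℝ | omegaRect ℂ 1 t r ≤ 1 + r}) * Real.log r ≤ 1.1 :=
  (uniformClause_iff_defect (by norm_num)).1 uniformClause_eleven_tenths r hr

/-- **The crux's clause, verbatim, for every rate `c ≥ 109/100`** (onset `t₀ = 0`):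
`∃ t₀ < 1, ∀ t ∈ [t₀,1), ∃ r ∈ [1, e^{c/(1−t)}], ω(1,t,r) ≤ 1 + r`.  (`SubexpSaturation` asks this for
every `c > 0`.) [cite: CoppersmithWinograd1990, §8] -/
theorem subexpClause_of_ge {c : ℝ} (hc : 109 / 100 ≤ c) :
    ∃ t₀ : ℝ, t₀ < 1 ∧ ∀ t : ℝ, t₀ ≤ t → t < 1 →
      ∃ r : ℝ, 1 ≤ r ∧ r ≤ Real.exp (c / (1 - t)) ∧ omegaRect ℂ 1 t r ≤ 1 + r :=
  ⟨0, by norm_num, fun t ht0 ht1 => uniformClause_mono hc uniformClause_109 t ht0 ht1⟩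

/-- The uniform constant is now `≤ 1.09 < log 4 − 0.296` (it was `2 log 2 = log 4` three kernels ago).
[cite: CoppersmithWinograd1990, §8] -/
theorem exists_uniformClause_le_109 :
    ∃ C : ℝ, C ≤ 109 / 100 ∧ C < Real.log 4 - 0.296 ∧ ∀ t : ℝ, 0 ≤ t → t < 1 → ∃ r : ℝ, 1 ≤ r ∧
      r ≤ Real.exp (C / (1 - t)) ∧ omegaRect ℂ 1 t r ≤ 1 + r :=
  ⟨109 / 100, le_rfl, by linarith [log_four_gt], uniformClause_109⟩

/-- Numerics recording the ceiling of the monotone family clause: `47 log 2 / 30 > 1.0859`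
(so no onset exists for rates `≤ 1.0859`; `log 2 > 0.6931471803`). [folklore] -/
theorem familyClause_ceiling_gt : (1.0859 : ℝ) < 47 * Real.log 2 / 30 := by
  have hl := Real.log_two_gt_d9
  linarith

/-- … and the rate inequality indeed FAILS at `j = 146` for `c = 1.09` (the onset `147` is sharp for
this certificate; `log 2 > 0.6931471803`). [folklore] -/
theorem rate_ineq_109_fails_146 :
    ¬ (((146 : ℕ) : ℝ) + 2) * (47 * ((146 : ℕ) : ℝ) + 37) * Real.log 2 ≤
      109 / 100 * ((((146 : ℕ) : ℝ) + 1) * (30 * ((146 : ℕ) : ℝ) + 37)) := by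
  have hl := Real.log_two_gt_d9
  push_cast
  nlinarith

end Summit.MatrixMultiplication.MatrixMultiplication.Theorems.SaturationLadderUniform109
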